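import Literature.MathematicalPhysics.QuantumLattice.LiebRobinsonHastingsKomaSpectralProofs
import Literature.MathematicalPhysics.QuantumLattice.LiebRobinsonGaussianFilterProofs
import HarnessLib

/-!
# Exponential clustering from the Lieb–Robinson bound, II: the theorem (Hastings–Koma / Nachtergaele–Sims)

Sibling proof file of `Literature/MathematicalPhysics/QuantumLattice/LiebRobinson.lean`. It **discharges
the named fact `hastings_koma`** (hubbard.S18: exponential clustering of the unique gapped ground
states of the box Hamiltonians `H_L` of a Hermitian finite-range bounded interaction on `ℤ^d`,
uniformly in `L`, with prefactor `min(|X|, |Y|)`) as `theorem hastings_koma_holds : hastings_koma d q`,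
from the Lieb–Robinson bound `lieb_robinson_holds` of `LiebRobinsonProofs.lean` and the analytic
filter lemmas of `LiebRobinsonGaussianFilterProofs.lean`; the spectral and dynamical lemmas are in
`LiebRobinsonHastingsKomaSpectralProofs.lean`. Theorems only: no definition and no named fact is
introduced.

## The printed proof and how it is followed (HK06 §3, proof of Thm. 8; NS06 §3.2)

Hastings–Koma write the ground-state expectation of the commutator
`⟨Φ, [A_X(t), B_Y] Φ⟩` in the eigenbasis of the finite-volume Hamiltonian (their displays following
"In terms of the ground state vectors …", here with `q = 1` ground state), extract its
negative-frequency part with the kernel `lim_{T,ε} (i/2π)∫_{-T}^T e^{-αt²} dt/(t + iε)` (Lemma 14: a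
Gaussian-smoothed Heaviside function of the energy, `= 1 + O(e^{-ΔE²/4α})` above the gap), bound the
time integral by the Lieb–Robinson estimate for `|t| ≤ cℓ` and by the Gaussian for `|t| > cℓ`, and
optimise `α`. We follow exactly this architecture:

* **Spectral resolution** (`dotProduct` form of Mathlib's `Matrix.IsHermitian.eigenvectorBasis`):
  `exp_smul_mulVec_eigenvectorBasis` (`e^{uH} vᵢ = e^{uλᵢ} vᵢ`), completeness and Parseval
  (`sum_dotProduct_smul_eigenvectorBasis`, `sum_norm_sq_dotProduct_eigenvectorBasis`), and the
  representation `commutator_expect_eq_sum`: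
  `⟨ψ,[A,τ_t(B)]ψ⟩ = Σᵢ (aᵢ e^{it(λᵢ-E₀)} - bᵢ e^{-it(λᵢ-E₀)})`, `aᵢ = ⟨ψ,Avᵢ⟩⟨vᵢ,Bψ⟩`,
  `bᵢ = ⟨ψ,Bvᵢ⟩⟨vᵢ,Aψ⟩` (HK06's four displays collapse to this for `q = 1`).
* **The gap** (`exists_ground_index`, from the tree's `IsHermitian.hasSpectralGap_iff_card_filter`
  and `HasSpectralGap.hasUniqueGroundState`): a unique index `i₀` carries `E₀`, all other
  `λᵢ ≥ E₀ + γ`, `ψ = c v_{i₀}` with `|c| = 1`; hence `a_{i₀} = b_{i₀} = ⟨A⟩⟨B⟩`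
  (`ground_term_eq`), `Σᵢ aᵢ = ⟨AB⟩` (`sum_dotProduct_mulVec_mul_dotProduct`), so the connected
  correlation is `Σ_{i ≠ i₀} aᵢ`, and `Σ‖aᵢ‖, Σ‖bᵢ‖ ≤ ‖A‖‖B‖` (`sum_norm_weights_le`).
* **The filter** is `abstract_clustering_bound` of `LiebRobinsonGaussianFilterProofs` (HK06 Lemma 14
  with the time integral split at `t₁` and `T`), fed with: the Lipschitz bound
  `‖h(t) - h(-t)‖ ≤ 4‖A‖‖[H,B]‖t` (`norm_commutator_expect_sub_le`, from the Heisenberg equation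
  of motion of the tree, `hasDerivAt_heisenbergEvolution`, and the mean value inequality) with
  `‖[H_Λ, B]‖ ≤ 2‖B‖|Y| 2^{|box ⌊R⌋|} max(J,0)` uniformly in the volume
  (`norm_commutator_boxlike_le`: locality `commute_of_disjoint_holds` and the finite-range count
  `HasFiniteRange.subset_image_box` of the tree); the Lieb–Robinson bound in the form
  `‖h(t)‖ ≤ C m ‖A‖‖B‖ e^{-μd} e^{μv|t|}`; and the trivial bound `2‖A‖‖B‖`.
* **Parameters** (`clustering_core`, `clustering_arith`): `T = d/2v`, `t₁ = e^{-μd/4}`,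
  `α = γv/d` (HK06: "choosing `α = ΔE/(2cℓ)`", "`c = η/(v + ΔE/2)`"), giving the decay length
  `ξ = max(8/μ, 4v/γ)` and the constant `2 + 4N + 4C/(vμ) + 8v/γ` (`N = 2^{|box ⌊R⌋|} max(J,0)`)
  for `d(X,Y) ≥ max(2v, 1)`; shorter distances and overlapping supports are covered by the trivial
  bound (constant `2e^{max(2v,1)/ξ}`), empty regions give scalar observables and zero correlation
  (`clustering_card_right`). The `min(|X|,|Y|)` prefactor of the statement follows by applying the
  `|Y|`-version also to the adjoint pair `(Bᴴ, Aᴴ)` (`norm_corr_conjTranspose_swap`):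
  `hastings_koma_of_lieb_robinson`, and `hastings_koma_holds` plugs in `lieb_robinson_holds`.

Deviations from print: finite-volume statement with `P₀ = |ψ⟩⟨ψ|` throughout (no weak-* limit);
the kernel's principal value and the limits `T → ∞`, `ε ↓ 0` are replaced by finite bookkeeping
(see `LiebRobinsonGaussianFilterProofs`); the Lieb–Robinson input lacks NS06's factor
`(e^{μv|t|} - 1)`, so the `1/t` singularity at `0` is handled by the Lipschitz bound (this is where
the `|Y|` of the prefactor enters, exactly as the `2|Y|/π` in NS06's `c(A,B)`); constants are not
optimised (`μ̃ = μ/(1 + 2v/ΔE)` is not claimed).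

## References

* M. B. Hastings, T. Koma, *Spectral gap and exponential decay of correlations*, CMP **265** (2006)
  781–804, §3 (proof of Thm. 8) and Lemma 14; arXiv:math-ph/0507008 pp. 6–7.
  [HastingsKomaCMP2006]
* B. Nachtergaele, R. Sims, *Lieb–Robinson bounds and the exponential clustering theorem*, CMP
  **265** (2006) 119–130, Thm. 2 and §3.2; arXiv:math-ph/0506030 pp. 5–8. [NachtergaeleSimsCMP2006]
* B. Nachtergaele, Y. Ogata, R. Sims, J. Stat. Phys. **124** (2006) 1, Thm. 2.1 (the Lieb–Robinson
  input, `lieb_robinson_holds`). [NachtergaeleOgataSimsJSP2006]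
* Mathlib: `Matrix.IsHermitian.eigenvectorBasis`/`mulVec_eigenvectorBasis`,
  `OrthonormalBasis.sum_repr'`/`sum_sq_norm_inner_right`, `hasDerivAt_exp_smul_const'`,
  `Convex.norm_image_sub_le_of_norm_hasDerivWithin_le`, `Matrix.l2_opNorm_mulVec`,
  `Matrix.l2_opNorm_conjTranspose`, `finrank_eq_one_iff_of_nonzero'`,
  `Real.sum_mul_le_sqrt_mul_sqrt`; the tree: `norm_heisenbergEvolution_holds`,
  `commute_of_disjoint_holds`, `norm_localOp_holds`, `norm_vectorState_le`, `norm_connCorr_le`,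
  `exists_eq_smul_one_of_isSupportedOn_empty`, `l2_opNorm_reindex`.
-/

noncomputable section

open Matrix Complex Finset Real
open scoped Matrix.Norms.L2Operator ComplexOrder InnerProductSpace

namespace Literature.MathematicalPhysics.QuantumLattice

/-! ### Assembly helpers -/

section AssemblyHelpers

open Literature.Probability.LatticeModels

variable {d q : ℕ}

/-- Regions at positive distance are disjoint. NS06 §2. [folklore] -/
theorem disjoint_of_setDist_pos {X Y : Finset (Site d)} (h : 0 < setDist X Y) : Disjoint X Y := by
  rw [Finset.disjoint_left]
  intro x hx hy
  have h' := setDist_le_dist hx hy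
  rw [dist_self] at h'
  linarith

/-- Disjoint regions stay disjoint inside the volume. NS06 §2. [folklore] -/
theorem disjoint_inVolume {Λ X Y : Finset (Site d)} (h : Disjoint X Y) :
    Disjoint (inVolume Λ X) (inVolume Λ Y) := by
  rw [Finset.disjoint_left] at h ⊢
  intro z hzX hzY
  exact h (mem_inVolume.1 hzX) (mem_inVolume.1 hzY)

/-- `|X ∩ Λ| ≤ |X|`. [folklore] -/
theorem card_inVolume_le (Λ X : Finset (Site d)) : #(inVolume Λ X) ≤ #X := by
  rw [inVolume, Finset.card_subtype]
  exact Finset.card_filter_le _ _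

/-- `⟨ψ, M ψ⟩⋆ = ⟨ψ, Mᴴ ψ⟩`. [folklore] -/
theorem star_opExpect {m : Type*} [Fintype m] (M : Matrix m m ℂ) (ψ : m → ℂ) :
    star (opExpect M ψ) = opExpect Mᴴ ψ := by
  rw [opExpect, opExpect, star_dotProduct, star_star, star_mulVec, ← dotProduct_mulVec]

/-- The connected correlation of `(A, B)` and of `(Bᴴ, Aᴴ)` have the same size (complex
conjugation). [folklore] -/
theorem norm_corr_conjTranspose_swap {m : Type*} [Fintype m] (A B : Matrix m m ℂ) (ψ : m → ℂ) :
    ‖opExpect (Bᴴ * Aᴴ) ψ - opExpect Bᴴ ψ * opExpect Aᴴ ψ‖ =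
      ‖opExpect (A * B) ψ - opExpect A ψ * opExpect B ψ‖ := by
  rw [← conjTranspose_mul, ← star_opExpect, ← star_opExpect, ← star_opExpect, mul_comm,
    ← star_mul, ← star_sub, norm_star, mul_comm]

/-- `x e^{-x} ≤ 1`, in the form `D e^{-cD} ≤ 1/c` for `c > 0`, `D ≥ 0`. [folklore] -/
theorem mul_exp_neg_mul_le {c D : ℝ} (hc : 0 < c) :
    D * Real.exp (-(c * D)) ≤ 1 / c := by
  have h1 : c * D ≤ Real.exp (c * D) := by linarith [Real.add_one_le_exp (c * D)]
  rw [Real.exp_neg, le_div_iff₀ hc]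
  have h2 : 0 < Real.exp (c * D) := Real.exp_pos _
  calc D * (Real.exp (c * D))⁻¹ * c = (c * D) / Real.exp (c * D) := by ring
    _ ≤ Real.exp (c * D) / Real.exp (c * D) := div_le_div_of_nonneg_right h1 h2.le
    _ = 1 := div_self h2.ne'

/-- **The arithmetic of the parameter choice** `T = d/2v`, `t₁ = e^{-μd/4}`, `α = γv/d` in the
bound of `abstract_clustering_bound`: for `d ≥ max(2v, 1)` the five terms are each at most a constant
times `‖A‖‖B‖|Y| e^{-d/ξ}` with `ξ = max(8/μ, 4v/γ)` (HK06 §3: "choosing `α = ΔE/(2cℓ)` …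
`c = η/(v + ΔE/2)`"; NS06 (3.25)–(3.28)). Pure real arithmetic. [folklore] -/
theorem clustering_arith {C μ v γ N D nA nB cY m S : ℝ} (hC : 0 ≤ C) (hμ : 0 < μ) (hv : 0 < v)
    (hγ : 0 < γ) (hN : 0 ≤ N) (hD1 : 1 ≤ D) (hD2 : 2 * v ≤ D) (hnA : 0 ≤ nA) (hnB : 0 ≤ nB)
    (hcY : 1 ≤ cY) (hm0 : 0 ≤ m) (hm : m ≤ cY)
    (key : S ≤ 0 / 2 + 2 * (nA * nB) * Real.exp (-γ ^ 2 / (4 * (γ * v / D))) +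
      (4 * nA * (2 * nB * (cY * N)) * Real.exp (-(μ * D / 4)) / 2 +
        C * nB * nA * m * Real.exp (-μ * D) * Real.exp (μ * v * (D / (2 * v))) * (D / (2 * v)) /
          Real.exp (-(μ * D / 4)) +
        2 * nA * nB * Real.exp (-(γ * v / D) * (D / (2 * v)) ^ 2) /
          (γ * v / D * (D / (2 * v)) ^ 2)) / π) :
    S ≤ (2 + 4 * N + 4 * C / (v * μ) + 8 * v / γ) * nA * nB * cY *
      Real.exp (-D / max (8 / μ) (4 * v / γ)) := by
  set ξ : ℝ := max (8 / μ) (4 * v / γ) with hξ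
  have hξ8 : 8 / μ ≤ ξ := le_max_left _ _
  have hξ4 : 4 * v / γ ≤ ξ := le_max_right _ _
  have hξ0 : 0 < ξ := lt_of_lt_of_le (by positivity) hξ8
  have hD0 : 0 < D := by linarith
  set E : ℝ := Real.exp (-D / ξ) with hE
  have hE0 : 0 < E := Real.exp_pos _
  have hK0 : 0 ≤ nA * nB := mul_nonneg hnA hnB
  -- comparison of rates with `1/ξ`
  have hrate1 : D / ξ ≤ γ * D / (4 * v) := by
    rw [div_le_div_iff₀ hξ0 (by positivity)]
    have : D * (4 * v) = (4 * v / γ) * (γ * D) := by field_simp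
    rw [this]
    calc 4 * v / γ * (γ * D) ≤ ξ * (γ * D) := mul_le_mul_of_nonneg_right hξ4 (by positivity)
      _ = γ * D * ξ := by ring
  have hrate2 : D / ξ ≤ μ * D / 8 := by
    rw [div_le_div_iff₀ hξ0 (by norm_num)]
    have : D * 8 = (8 / μ) * (μ * D) := by field_simp
    rw [this]
    calc 8 / μ * (μ * D) ≤ ξ * (μ * D) := mul_le_mul_of_nonneg_right hξ8 (by positivity)
      _ = μ * D * ξ := by ring
  have hexp1 : Real.exp (-(γ * D / (4 * v))) ≤ E := by
    rw [hE, Real.exp_le_exp, neg_div]; linarith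
  have hexp2 : Real.exp (-(μ * D / 8)) ≤ E := by
    rw [hE, Real.exp_le_exp, neg_div]; linarith
  have hexp3 : Real.exp (-(μ * D / 4)) ≤ E := by
    refine le_trans (Real.exp_le_exp.2 ?_) hexp2
    nlinarith [mul_pos hμ hD0]
  -- term 1
  have hT1 : 2 * (nA * nB) * Real.exp (-γ ^ 2 / (4 * (γ * v / D))) ≤ 2 * (nA * nB) * cY * E := by
    have e : -γ ^ 2 / (4 * (γ * v / D)) = -(γ * D / (4 * v)) := by field_simp
    rw [e]
    calc 2 * (nA * nB) * Real.exp (-(γ * D / (4 * v))) ≤ 2 * (nA * nB) * E :=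
          mul_le_mul_of_nonneg_left hexp1 (by positivity)
      _ = 2 * (nA * nB) * 1 * E := by ring
      _ ≤ 2 * (nA * nB) * cY * E := by gcongr
  -- term 2
  have hT2 : 4 * nA * (2 * nB * (cY * N)) * Real.exp (-(μ * D / 4)) / 2 ≤
      4 * N * (nA * nB) * cY * E := by
    have : 4 * nA * (2 * nB * (cY * N)) * Real.exp (-(μ * D / 4)) / 2 =
        4 * N * (nA * nB) * cY * Real.exp (-(μ * D / 4)) := by ring
    rw [this]
    exact mul_le_mul_of_nonneg_left hexp3 (by positivity)
  -- term 3
  have hT3 : C * nB * nA * m * Real.exp (-μ * D) * Real.exp (μ * v * (D / (2 * v))) * (D / (2 * v)) /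
      Real.exp (-(μ * D / 4)) ≤ 4 * C / (v * μ) * (nA * nB) * cY * E := by
    have e1 : Real.exp (-μ * D) * Real.exp (μ * v * (D / (2 * v))) / Real.exp (-(μ * D / 4)) =
        Real.exp (-(μ * D / 8)) * Real.exp (-(μ / 8 * D)) := by
      rw [← Real.exp_add, ← Real.exp_sub, ← Real.exp_add]
      congr 1
      field_simp
      ring
    have e2 : C * nB * nA * m * Real.exp (-μ * D) * Real.exp (μ * v * (D / (2 * v))) * (D / (2 * v)) /
        Real.exp (-(μ * D / 4)) =
        C * (nA * nB) * m / (2 * v) * D *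
          (Real.exp (-μ * D) * Real.exp (μ * v * (D / (2 * v))) / Real.exp (-(μ * D / 4))) := by
      field_simp
    rw [e2, e1]
    have h8 : D * Real.exp (-(μ / 8 * D)) ≤ 1 / (μ / 8) := mul_exp_neg_mul_le (by positivity)
    calc C * (nA * nB) * m / (2 * v) * D * (Real.exp (-(μ * D / 8)) * Real.exp (-(μ / 8 * D)))
        = C * (nA * nB) * m / (2 * v) * Real.exp (-(μ * D / 8)) * (D * Real.exp (-(μ / 8 * D))) := by
          ring
      _ ≤ C * (nA * nB) * cY / (2 * v) * E * (1 / (μ / 8)) := by gcongr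
      _ = 4 * C / (v * μ) * (nA * nB) * cY * E := by field_simp; ring
  -- term 4
  have hT4 : 2 * nA * nB * Real.exp (-(γ * v / D) * (D / (2 * v)) ^ 2) /
      (γ * v / D * (D / (2 * v)) ^ 2) ≤ 8 * v / γ * (nA * nB) * cY * E := by
    have e1 : -(γ * v / D) * (D / (2 * v)) ^ 2 = -(γ * D / (4 * v)) := by field_simp; ring
    have e2 : γ * v / D * (D / (2 * v)) ^ 2 = γ * D / (4 * v) := by field_simp; ring
    rw [e1, e2]
    have hden : 0 < γ * D / (4 * v) := by positivity
    rw [div_le_iff₀ hden]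
    calc 2 * nA * nB * Real.exp (-(γ * D / (4 * v))) ≤ 2 * nA * nB * E := by
          exact mul_le_mul_of_nonneg_left hexp1 (by positivity)
      _ = 8 * v / γ * (nA * nB) * 1 * E * (γ * 1 / (4 * v)) := by field_simp; ring
      _ ≤ 8 * v / γ * (nA * nB) * cY * E * (γ * D / (4 * v)) := by gcongr
  -- the bracket divided by `π` is at most the bracket
  have hsum_nonneg : 0 ≤ 4 * nA * (2 * nB * (cY * N)) * Real.exp (-(μ * D / 4)) / 2 +
      C * nB * nA * m * Real.exp (-μ * D) * Real.exp (μ * v * (D / (2 * v))) * (D / (2 * v)) /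
        Real.exp (-(μ * D / 4)) +
      2 * nA * nB * Real.exp (-(γ * v / D) * (D / (2 * v)) ^ 2) /
        (γ * v / D * (D / (2 * v)) ^ 2) := by positivity
  have hpi : (4 * nA * (2 * nB * (cY * N)) * Real.exp (-(μ * D / 4)) / 2 +
      C * nB * nA * m * Real.exp (-μ * D) * Real.exp (μ * v * (D / (2 * v))) * (D / (2 * v)) /
        Real.exp (-(μ * D / 4)) +
      2 * nA * nB * Real.exp (-(γ * v / D) * (D / (2 * v)) ^ 2) /
        (γ * v / D * (D / (2 * v)) ^ 2)) / π ≤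
      4 * nA * (2 * nB * (cY * N)) * Real.exp (-(μ * D / 4)) / 2 +
      C * nB * nA * m * Real.exp (-μ * D) * Real.exp (μ * v * (D / (2 * v))) * (D / (2 * v)) /
        Real.exp (-(μ * D / 4)) +
      2 * nA * nB * Real.exp (-(γ * v / D) * (D / (2 * v)) ^ 2) /
        (γ * v / D * (D / (2 * v)) ^ 2) :=
    div_le_self hsum_nonneg (by linarith [Real.two_le_pi])
  have htot : (2 + 4 * N + 4 * C / (v * μ) + 8 * v / γ) * nA * nB * cY * E =
      2 * (nA * nB) * cY * E + 4 * N * (nA * nB) * cY * E + 4 * C / (v * μ) * (nA * nB) * cY * E +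
        8 * v / γ * (nA * nB) * cY * E := by ring
  rw [htot]
  linarith


/-- `e^{-μD/4} ≤ D/(2v)` for `D ≥ 2v > 0`, `μ > 0` (admissibility `t₁ ≤ T` of the parameters).
[folklore] -/
theorem exp_le_div_of_le {μ v D : ℝ} (hμ : 0 < μ) (hv : 0 < v) (hD0 : 0 < D) (hD2 : 2 * v ≤ D) :
    Real.exp (-(μ * D / 4)) ≤ D / (2 * v) := by
  calc Real.exp (-(μ * D / 4)) ≤ 1 := by
        rw [Real.exp_le_one_iff]; nlinarith [mul_pos hμ hD0]
    _ ≤ D / (2 * v) := by rw [le_div_iff₀ (by positivity)]; linarith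


/-- Weakening a constant to its positive part. [folklore] -/
theorem mul_le_max_mul {C₀ x : ℝ} (hx : 0 ≤ x) : C₀ * x ≤ max C₀ 0 * x :=
  mul_le_mul_of_nonneg_right (le_max_left _ _) hx

/-- Monotonicity of the final constant (in the left-associated four-factor shape of the
statement). [folklore] -/
theorem mul_le_add_mul {K₀ e a b c d' : ℝ} (hx : 0 ≤ a * b * c * d') (he : 0 ≤ e) :
    K₀ * a * b * c * d' ≤ (K₀ + e) * a * b * c * d' := by
  have h1 : (K₀ + e) * a * b * c * d' = K₀ * a * b * c * d' + e * (a * b * c * d') := by ring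
  rw [h1]
  nlinarith [mul_nonneg he hx]

/-- Nonnegativity of the right-hand side (left-associated shape). [folklore] -/
theorem mul_nonneg_of_four {k a b c d' : ℝ} (hk : 0 ≤ k) (hx : 0 ≤ a * b * c * d') :
    0 ≤ k * a * b * c * d' := by
  have h1 : k * a * b * c * d' = k * (a * b * c * d') := by ring
  rw [h1]
  exact mul_nonneg hk hx

/-- The short-distance case of the clustering bound: `2 ≤ (K₀ + 2e^{D₀/ξ}) |Y| e^{-d/ξ}` for
`0 ≤ d ≤ D₀`, `|Y| ≥ 1`. [folklore] -/
theorem two_mul_le_of_short {K₀ D₀ ξ d nA nB cY : ℝ} (hK₀ : 0 ≤ K₀) (hξ : 0 < ξ)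
    (hd : d ≤ D₀) (hcY : 1 ≤ cY) (hnA : 0 ≤ nA) (hnB : 0 ≤ nB) :
    2 * nA * nB ≤ (K₀ + 2 * Real.exp (D₀ / ξ)) * nA * nB * cY * Real.exp (-d / ξ) := by
  have h1 : 1 ≤ Real.exp (D₀ / ξ) * Real.exp (-d / ξ) := by
    rw [← Real.exp_add]
    exact Real.one_le_exp (by
      rw [neg_div, ← sub_eq_add_neg, sub_nonneg]
      exact div_le_div_of_nonneg_right hd hξ.le)
  have h2 : 0 ≤ K₀ * nA * nB * cY * Real.exp (-d / ξ) := by positivity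
  have h3 : 2 * nA * nB * 1 ≤ 2 * nA * nB * (Real.exp (D₀ / ξ) * Real.exp (-d / ξ)) * cY := by
    calc 2 * nA * nB * 1 ≤ 2 * nA * nB * (Real.exp (D₀ / ξ) * Real.exp (-d / ξ)) :=
          mul_le_mul_of_nonneg_left h1 (by positivity)
      _ = 2 * nA * nB * (Real.exp (D₀ / ξ) * Real.exp (-d / ξ)) * 1 := by ring
      _ ≤ 2 * nA * nB * (Real.exp (D₀ / ξ) * Real.exp (-d / ξ)) * cY :=
          mul_le_mul_of_nonneg_left hcY (by positivity)
  nlinarith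

/-- `⟨ψ, (b𝟙) ψ⟩ = b` for a normalised `ψ`, and the two mixed products. [folklore] -/
theorem opExpect_mul_smul_one {m : Type*} [Fintype m] [DecidableEq m] (A : Matrix m m ℂ) (b : ℂ)
    (ψ : m → ℂ) : opExpect (A * (b • (1 : Matrix m m ℂ))) ψ = b * opExpect A ψ := by
  simp only [opExpect, Matrix.mul_smul, Matrix.mul_one, Matrix.smul_mulVec, dotProduct_smul,
    smul_eq_mul]

/-- `⟨ψ, (a𝟙) B ψ⟩ = a ⟨ψ, Bψ⟩`. [folklore] -/
theorem opExpect_smul_one_mul {m : Type*} [Fintype m] [DecidableEq m] (B : Matrix m m ℂ) (a : ℂ)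
    (ψ : m → ℂ) : opExpect ((a • (1 : Matrix m m ℂ)) * B) ψ = a * opExpect B ψ := by
  simp only [opExpect, Matrix.smul_mul, Matrix.one_mul, Matrix.smul_mulVec, dotProduct_smul,
    smul_eq_mul]

/-- `⟨ψ, (b𝟙) ψ⟩ = b ⟨ψ, ψ⟩`. [folklore] -/
theorem opExpect_smul_one {m : Type*} [Fintype m] [DecidableEq m] (b : ℂ) (ψ : m → ℂ) :
    opExpect (b • (1 : Matrix m m ℂ)) ψ = b * (star ψ ⬝ᵥ ψ) := by
  simp only [opExpect, Matrix.smul_mulVec, Matrix.one_mulVec, dotProduct_smul, smul_eq_mul]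

/-- The empty region inside a volume is empty. [folklore] -/
theorem inVolume_empty (Λ : Finset (Site d)) : inVolume Λ (∅ : Finset (Site d)) = ∅ := by
  ext x; simp [inVolume]

end AssemblyHelpers


/-! ### The core estimate -/

section Core

open Literature.Probability.LatticeModels

variable {d q : ℕ}

/-- **The core of the exponential clustering theorem** (HK06 Thm. 8 with `q = 1`, finite volume;
NS06 Thm. 2), at fixed volume `Λ_L`, for regions at distance `≥ max(2v, 1)` and prefactor `|Y|`:
given the Lieb–Robinson bound with constants `(C, μ, v)` and a gap `γ`, the connected correlation in
a normalised ground state satisfies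
`|⟨AB⟩ - ⟨A⟩⟨B⟩| ≤ (2 + 4N + 4C/(vμ) + 8v/γ) ‖A‖ ‖B‖ |Y| e^{-d(X,Y)/ξ}`, `ξ = max(8/μ, 4v/γ)`,
`N = 2^{|box ⌊R⌋|} max(J,0)`. Proof: `abstract_clustering_bound` with the spectral data of
`commutator_expect_eq_sum`, the Lipschitz constant `8N|Y|‖A‖‖B‖`
(`norm_heisenbergEvolution_sub_le`, `norm_commutator_boxlike_le`), the Lieb–Robinson constant
`C m ‖A‖‖B‖ e^{-μd}` at rate `μv`, the trivial bound `2‖A‖‖B‖`, and the parameters `T = d/2v`,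
`t₁ = e^{-μd/4}`, `α = γv/d` (HK06: "choosing `α = ΔE/(2cℓ)`"; NS06 (3.25)–(3.27)).
[cite: HastingsKomaCMP2006, Theorem 8 (proof, §3)] -/
theorem clustering_core (Φ : LatticeInteraction d q) {R J : ℝ} (hH : Φ.IsHermitian)
    (hR : Φ.HasFiniteRange R) (hJ : Φ.IsBounded J) {C μ v γ : ℝ} (hC : 0 ≤ C) (hμ : 0 < μ)
    (hv : 0 < v) (hγ : 0 < γ)
    (hLR : ∀ (Λ X Y : Finset (Site d)), X ⊆ Λ → Y ⊆ Λ →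
      ∀ (A B : Op ↥Λ q), IsSupportedOn A (inVolume Λ X) → IsSupportedOn B (inVolume Λ Y) →
        ∀ t : ℝ,
          ‖heisenbergEvolution (localHamiltonian (Φ.restrict Λ) univ) t A * B -
              B * heisenbergEvolution (localHamiltonian (Φ.restrict Λ) univ) t A‖ ≤
            C * ‖A‖ * ‖B‖ * (min X.card Y.card : ℕ) * Real.exp (-μ * (setDist X Y - v * |t|)))
    (L : ℕ) (hgap : (boxHamiltonian Φ L).HasSpectralGap γ) (X Y : Finset (Site d))
    (hX : X ⊆ box d L) (hY : Y ⊆ box d L) (A B : Op ↥(box d L) q)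
    (ψ : TensorIndex ↥(box d L) q → ℂ) (hψ : (boxHamiltonian Φ L).IsGroundStateVector ψ)
    (hψ1 : star ψ ⬝ᵥ ψ = 1) (hA : IsSupportedOn A (inVolume (box d L) X))
    (hB : IsSupportedOn B (inVolume (box d L) Y)) (hYne : Y.Nonempty)
    (hD : max (2 * v) 1 ≤ setDist X Y) :
    ‖opExpect (A * B) ψ - opExpect A ψ * opExpect B ψ‖ ≤
      (2 + 4 * (2 ^ #(box d ⌊R⌋₊) * max J 0) + 4 * C / (v * μ) + 8 * v / γ) * ‖A‖ * ‖B‖ * #Y *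
        Real.exp (-setDist X Y / max (8 / μ) (4 * v / γ)) := by
  -- `q ≠ 0`: otherwise the configuration space is empty and `ψ` cannot be normalised
  have hq : NeZero q := by
    refine ⟨fun hq0 => ?_⟩
    subst hq0
    haveI : Nonempty ↥(box d L) := ⟨⟨0, zero_mem_box d L⟩⟩
    haveI : IsEmpty (TensorIndex ↥(box d L) 0) := by
      change IsEmpty (↥(box d L) → Fin 0)
      infer_instance
    simp [dotProduct] at hψ1
  -- make the Hamiltonian and the distance opaque
  obtain ⟨Hm, hHm⟩ : ∃ Hm : Op ↥(box d L) q, boxHamiltonian Φ L = Hm := ⟨_, rfl⟩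
  have hHerm : Hm.IsHermitian := hHm ▸ boxHamiltonian_isHermitian hH L
  have hLR' : ∀ t : ℝ, ‖heisenbergEvolution Hm t B * A - A * heisenbergEvolution Hm t B‖ ≤
      C * ‖B‖ * ‖A‖ * (min #Y #X : ℕ) * Real.exp (-μ * (setDist Y X - v * |t|)) := by
    intro t
    have h := hLR (box d L) Y X hY hX B A hB hA t
    rwa [show localHamiltonian (Φ.restrict (box d L)) univ = Hm from hHm] at h
  have hcomm : ‖Hm * B - B * Hm‖ ≤ 2 * ‖B‖ * (#Y * (2 ^ #(box d ⌊R⌋₊) * max J 0)) := by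
    have h := norm_commutator_boxlike_le hH hR hJ (box d L) hB
    rw [show localHamiltonian (Φ.restrict (box d L)) univ = Hm from hHm] at h
    refine h.trans (mul_le_mul_of_nonneg_left ?_ (mul_nonneg zero_le_two (norm_nonneg B)))
    refine mul_le_mul_of_nonneg_right ?_ (mul_nonneg (pow_nonneg zero_le_two _) (le_max_right _ _))
    exact_mod_cast card_inVolume_le _ _
  rw [hHm] at hψ hgap
  obtain ⟨D, hDdef⟩ : ∃ D : ℝ, setDist X Y = D := ⟨_, rfl⟩
  rw [setDist_comm Y X, hDdef] at hLR'
  rw [hDdef] at hD ⊢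
  have hD1 : 1 ≤ D := le_trans (le_max_right _ _) hD
  have hD2v : 2 * v ≤ D := le_trans (le_max_left _ _) hD
  have hD0 : 0 < D := lt_of_lt_of_le one_pos hD1
  have hdisj : Disjoint X Y := disjoint_of_setDist_pos (X := X) (Y := Y) (by rw [hDdef]; exact hD0)
  have hdisj' : Disjoint (inVolume (box d L) X) (inVolume (box d L) Y) := disjoint_inVolume hdisj
  have hYcard : (1 : ℝ) ≤ #Y := by exact_mod_cast hYne.card_pos
  -- constants
  obtain ⟨N, hN⟩ : ∃ N : ℝ, 2 ^ #(box d ⌊R⌋₊) * max J 0 = N := ⟨_, rfl⟩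
  have hN0 : 0 ≤ N := hN ▸ mul_nonneg (pow_nonneg zero_le_two _) (le_max_right _ _)
  rw [hN] at hcomm ⊢
  have hmY : ((min #Y #X : ℕ) : ℝ) ≤ #Y := by exact_mod_cast min_le_left _ _
  have hm0 : (0 : ℝ) ≤ (min #Y #X : ℕ) := Nat.cast_nonneg _
  -- the ground state along the eigenbasis
  obtain ⟨i₀, c, hev0, hothers, hψc, hc⟩ := exists_ground_index hHerm hgap hψ hψ1
  have hψeig : Hm *ᵥ ψ = ((Hm.groundEnergy : ℝ) : ℂ) • ψ := hψ.2
  -- the data of the abstract bound (opaque functions with defining equations)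
  obtain ⟨a, ha⟩ : ∃ a : TensorIndex ↥(box d L) q → ℂ, ∀ i, a i =
      (star ψ ⬝ᵥ (A *ᵥ ⇑(hHerm.eigenvectorBasis i))) *
        (star (⇑(hHerm.eigenvectorBasis i)) ⬝ᵥ (B *ᵥ ψ)) := ⟨_, fun i => rfl⟩
  obtain ⟨b, hb⟩ : ∃ b : TensorIndex ↥(box d L) q → ℂ, ∀ i, b i =
      (star ψ ⬝ᵥ (B *ᵥ ⇑(hHerm.eigenvectorBasis i))) *
        (star (⇑(hHerm.eigenvectorBasis i)) ⬝ᵥ (A *ᵥ ψ)) := ⟨_, fun i => rfl⟩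
  obtain ⟨Δ, hΔ⟩ : ∃ Δ : TensorIndex ↥(box d L) q → ℝ, ∀ i,
      Δ i = hHerm.eigenvalues i - Hm.groundEnergy := ⟨_, fun i => rfl⟩
  obtain ⟨hfun, hhfun⟩ : ∃ hfun : ℝ → ℂ, ∀ t, hfun t =
      star ψ ⬝ᵥ ((A * heisenbergEvolution Hm t B - heisenbergEvolution Hm t B * A) *ᵥ ψ) :=
    ⟨_, fun t => rfl⟩
  -- hypotheses of the abstract bound
  have hΔ₀ : Δ i₀ = 0 := by rw [hΔ, hev0, sub_self]
  have hΔγ : ∀ i, i ≠ i₀ → γ ≤ Δ i := fun i hi => by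
    rw [hΔ, le_sub_iff_add_le, add_comm]; exact hothers i hi
  have hab : a i₀ = b i₀ := by
    rw [ha, hb, ground_term_eq A B hψc hc, ground_term_eq B A hψc hc, mul_comm]
  have hKa : ∑ i, ‖a i‖ ≤ ‖A‖ * ‖B‖ := by
    simp only [ha]; exact sum_norm_weights_le hHerm A B hψ1
  have hKb : ∑ i, ‖b i‖ ≤ ‖A‖ * ‖B‖ := by
    simp only [hb]; rw [mul_comm]; exact sum_norm_weights_le hHerm B A hψ1
  have hh : ∀ t : ℝ, hfun t =
      ∑ i, (a i * cexp ((t * Δ i : ℝ) * I) - b i * cexp (-(t * Δ i : ℝ) * I)) := fun t => by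
    simp only [hhfun, ha, hb, hΔ]
    exact commutator_expect_eq_sum hHerm A B hψeig t
  have hL1 : ∀ t : ℝ, 0 < t → ‖hfun t - hfun (-t)‖ ≤ 4 * ‖A‖ * (2 * ‖B‖ * (#Y * N)) * t := by
    intro t ht
    rw [hhfun, hhfun]
    exact norm_commutator_expect_sub_le hHerm A B hψ1 hcomm ht
  have hL2 : ∀ t : ℝ, ‖hfun t‖ ≤
      C * ‖B‖ * ‖A‖ * (min #Y #X : ℕ) * Real.exp (-μ * D) * Real.exp (μ * v * |t|) := by
    intro t
    rw [hhfun]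
    refine norm_commutator_expect_le_of_le hψ1 ((hLR' t).trans (le_of_eq ?_))
    rw [show -μ * (D - v * |t|) = -μ * D + μ * v * |t| by ring, Real.exp_add, ← mul_assoc]
  have hL3 : ∀ t : ℝ, ‖hfun t‖ ≤ 2 * ‖A‖ * ‖B‖ := by
    intro t
    rw [hhfun]
    exact norm_commutator_expect_le hHerm A B hψ1 t
  -- parameters (all side conditions are real arithmetic on `D, μ, v, γ`)
  have hα : 0 < γ * v / D := div_pos (mul_pos hγ hv) hD0
  have ht₁ : 0 < Real.exp (-(μ * D / 4)) := Real.exp_pos _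
  have hT : Real.exp (-(μ * D / 4)) ≤ D / (2 * v) := exp_le_div_of_le hμ hv hD0 hD2v
  have key := abstract_clustering_bound i₀ Δ a b hfun hγ hα ht₁ hT (mul_pos hμ hv).le hΔ₀ hΔγ
    hab hKa hKb hh hL1 hL2 hL3
  -- identify the left-hand side with the connected correlation, and `h(0) = 0`
  have h0 : hfun 0 = 0 := by
    rw [hhfun]
    exact commutator_expect_zero_of_commute ψ (commute_of_disjoint_holds hA hB hdisj')
  have hsumall : ∑ i, a i = opExpect (A * B) ψ := by
    simp only [ha]
    rw [sum_dotProduct_mulVec_mul_dotProduct hHerm A ψ (B *ᵥ ψ), opExpect, ← mulVec_mulVec]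
  have hai₀ : a i₀ = opExpect A ψ * opExpect B ψ := by
    rw [ha, ground_term_eq A B hψc hc]
    rfl
  rw [Finset.sum_erase_eq_sub (Finset.mem_univ i₀), hsumall, hai₀, h0, norm_zero] at key
  exact clustering_arith hC hμ hv hγ hN0 hD1 hD2v (norm_nonneg A) (norm_nonneg B) hYcard hm0 hmY key

/-! ### The theorem -/

/-- **Exponential clustering with prefactor `|Y|`**, uniformly in the volume, from the Lieb–Robinson
bound: the case analysis (empty regions: scalar observables, zero correlation; short distance
`d(X,Y) < max(2v,1)`: the trivial bound `2‖A‖‖B‖`; long distance: `clustering_core`).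
HK06 Thm. 8 / NS06 Thm. 2 (with `|Y|` as in NS06's `c(A,B)`). [cite: HastingsKomaCMP2006, Theorem 8] -/
theorem clustering_card_right (hLR : lieb_robinson d q) (Φ : LatticeInteraction d q) {R J : ℝ}
    (hH : Φ.IsHermitian) (hR : Φ.HasFiniteRange R) (hJ : Φ.IsBounded J)
    (hgap : ∃ γ > 0, ∀ L : ℕ, (boxHamiltonian Φ L).HasSpectralGap γ) :
    ∃ C ξ : ℝ, 0 < ξ ∧
      ∀ (L : ℕ) (X Y : Finset (Site d)), X ⊆ box d L → Y ⊆ box d L →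
        ∀ (A B : Op ↥(box d L) q) (ψ : TensorIndex ↥(box d L) q → ℂ),
          (boxHamiltonian Φ L).IsGroundStateVector ψ → star ψ ⬝ᵥ ψ = 1 →
          IsSupportedOn A (inVolume (box d L) X) → IsSupportedOn B (inVolume (box d L) Y) →
            ‖opExpect (A * B) ψ - opExpect A ψ * opExpect B ψ‖ ≤
              C * ‖A‖ * ‖B‖ * #Y * Real.exp (-setDist X Y / ξ) := by
  obtain ⟨γ, hγ, hgapL⟩ := hgap
  obtain ⟨C₀, μ, v, hμ, hv, hLR₀⟩ := hLR Φ hH hR hJ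
  -- Lieb–Robinson with a nonnegative constant
  have hLR₁ : ∀ (Λ X Y : Finset (Site d)), X ⊆ Λ → Y ⊆ Λ →
      ∀ (A B : Op ↥Λ q), IsSupportedOn A (inVolume Λ X) → IsSupportedOn B (inVolume Λ Y) →
        ∀ t : ℝ,
          ‖heisenbergEvolution (localHamiltonian (Φ.restrict Λ) univ) t A * B -
              B * heisenbergEvolution (localHamiltonian (Φ.restrict Λ) univ) t A‖ ≤
            max C₀ 0 * ‖A‖ * ‖B‖ * (min X.card Y.card : ℕ) *
              Real.exp (-μ * (setDist X Y - v * |t|)) := by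
    intro Λ X Y hX hY A B hA hB t
    have h := hLR₀ Λ X Y hX hY A B hA hB t
    simp only [mul_assoc] at h ⊢
    exact h.trans (mul_le_max_mul (mul_nonneg (norm_nonneg _) (mul_nonneg (norm_nonneg _)
      (mul_nonneg (Nat.cast_nonneg _) (Real.exp_pos _).le))))
  obtain ⟨ξ, hξ⟩ : ∃ ξ : ℝ, max (8 / μ) (4 * v / γ) = ξ := ⟨_, rfl⟩
  have hξ0 : 0 < ξ := hξ ▸ lt_max_of_lt_left (div_pos (by norm_num) hμ)
  obtain ⟨K₀, hK₀⟩ : ∃ K₀ : ℝ,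
      2 + 4 * (2 ^ #(box d ⌊R⌋₊) * max J 0) + 4 * max C₀ 0 / (v * μ) + 8 * v / γ = K₀ := ⟨_, rfl⟩
  have hK₀0 : 0 ≤ K₀ := by rw [← hK₀]; positivity
  obtain ⟨D₀, hD₀⟩ : ∃ D₀ : ℝ, max (2 * v) 1 = D₀ := ⟨_, rfl⟩
  refine ⟨K₀ + 2 * Real.exp (D₀ / ξ), ξ, hξ0, ?_⟩
  intro L X Y hX hY A B ψ hψ hψ1 hA hB
  have hnn : 0 ≤ ‖A‖ * ‖B‖ * #Y * Real.exp (-setDist X Y / ξ) :=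
    mul_nonneg (mul_nonneg (mul_nonneg (norm_nonneg _) (norm_nonneg _)) (Nat.cast_nonneg _))
      (Real.exp_pos _).le
  have he0 : (0 : ℝ) ≤ 2 * Real.exp (D₀ / ξ) := mul_nonneg zero_le_two (Real.exp_pos (D₀ / ξ)).le
  have hzero : (0 : ℝ) ≤ (K₀ + 2 * Real.exp (D₀ / ξ)) * ‖A‖ * ‖B‖ * #Y *
      Real.exp (-setDist X Y / ξ) := mul_nonneg_of_four (add_nonneg hK₀0 he0) hnn
  -- empty `Y`: `B` is a scalar
  by_cases hYe : Y = ∅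
  · subst hYe
    rw [inVolume_empty] at hB
    obtain ⟨b, rfl⟩ := exists_eq_smul_one_of_isSupportedOn_empty hB
    rw [opExpect_mul_smul_one, opExpect_smul_one, hψ1, mul_one, mul_comm, sub_self, norm_zero]
    exact hzero
  -- empty `X`: `A` is a scalar
  by_cases hXe : X = ∅
  · subst hXe
    rw [inVolume_empty] at hA
    obtain ⟨a, rfl⟩ := exists_eq_smul_one_of_isSupportedOn_empty hA
    rw [opExpect_smul_one_mul, opExpect_smul_one, hψ1, mul_one, sub_self, norm_zero]
    exact hzero
  have hYne : Y.Nonempty := Finset.nonempty_iff_ne_empty.2 hYe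
  have hYcard : (1 : ℝ) ≤ #Y := by exact_mod_cast hYne.card_pos
  by_cases hD : max (2 * v) 1 ≤ setDist X Y
  · -- long distance: the core estimate
    have h := clustering_core Φ hH hR hJ (le_max_right C₀ 0) hμ hv hγ hLR₁ L (hgapL L) X Y hX hY
      A B ψ hψ hψ1 hA hB hYne hD
    rw [hξ, hK₀] at h
    exact h.trans (mul_le_add_mul hnn he0)
  · -- short distance: the trivial bound
    have h := norm_connCorr_le (norm_vectorState_le hψ1) A B
    rw [connCorr_apply, vectorState_apply_eq_opExpect, vectorState_apply_eq_opExpect,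
      vectorState_apply_eq_opExpect] at h
    rw [hD₀] at hD
    exact h.trans (two_mul_le_of_short hK₀0 hξ0 (le_of_lt (not_le.1 hD)) hYcard (norm_nonneg A)
      (norm_nonneg B))

/-- **hubbard.S18 from hubbard.S17: exponential clustering of gapped ground states from the
Lieb–Robinson bound** (Hastings–Koma, CMP **265** (2006) Thm. 8 with `P₀ = |Ω⟩⟨Ω|`, finite volume
uniformly in `L`; Nachtergaele–Sims, CMP **265** (2006) Thm. 2). Assuming the named fact
`lieb_robinson d q` (NOS06 Thm. 1, the multi-site Lieb–Robinson bound), the named fact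
`hastings_koma d q` holds: the `min(|X|, |Y|)` prefactor is obtained from the `|Y|`-version
`clustering_card_right` applied to `(A, B)` and to the adjoint pair `(Bᴴ, Aᴴ)`
(`norm_corr_conjTranspose_swap`). [cite: HastingsKomaCMP2006, Theorem 8] -/
theorem hastings_koma_of_lieb_robinson (hLR : lieb_robinson d q) : hastings_koma d q := by
  intro Φ R J hH hR hJ hgap
  obtain ⟨C, ξ, hξ, h⟩ := clustering_card_right hLR Φ hH hR hJ hgap
  refine ⟨C, ξ, hξ, ?_⟩
  intro L X Y hX hY A B ψ hψ hψ1 hA hB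
  rcases le_total #Y #X with hle | hle
  · rw [min_eq_right hle]
    exact h L X Y hX hY A B ψ hψ hψ1 hA hB
  · rw [min_eq_left hle, ← norm_corr_conjTranspose_swap, setDist_comm]
    have hA' : IsSupportedOn Aᴴ (inVolume (box d L) X) := hA.star
    have hB' : IsSupportedOn Bᴴ (inVolume (box d L) Y) := hB.star
    have h' := h L Y X hY hX Bᴴ Aᴴ ψ hψ hψ1 hB' hA'
    rwa [Matrix.l2_opNorm_conjTranspose, Matrix.l2_opNorm_conjTranspose, mul_right_comm C ‖B‖ ‖A‖] at h'

/-- **Discharge of the named fact `hastings_koma` (hubbard.S18).** Exponential clustering of the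
unique gapped ground states of the box Hamiltonians of a Hermitian finite-range bounded interaction on
`ℤ^d`, uniformly in the box: Hastings–Koma, CMP **265** (2006) 781, Theorem 8 (with `q = 1`,
`P₀ = |Ω⟩⟨Ω|`, finite volume — the last display of the proof of Thm. 8, "for any finite lattice
`Λ_s ⊃ X, Y`"), proved along HK06 §3 / Nachtergaele–Sims CMP **265** (2006) Thm. 2 from the
Lieb–Robinson bound `lieb_robinson_holds` (NOS06 Thm. 2.1) through `hastings_koma_of_lieb_robinson`.
[cite: HastingsKomaCMP2006, Theorem 8] -/
theorem hastings_koma_holds : hastings_koma d q :=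
  hastings_koma_of_lieb_robinson lieb_robinson_holds

end Core

end Literature.MathematicalPhysics.QuantumLattice
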